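import Mathlib
import HarnessLib
import Summits.RiemannHypothesis.RiemannHypothesis.Theorems.DbrWallAntipersistenceConcave

/-!
# DBR column, rung B-P(P1): the LADDER LEMMA for anti-persistence beyond the wall

RH-FREE calculus lemma (LINE 1 of the label discipline): a convexity bookkeeping fact about the archimedean two-point
gap `D(s) = Σ_k(1 − e^{−λ'_k s})²/λ'_k² − 4(e^{s/2} − 1)²` of Suzuki2023 (1.1); NOT worded as, and not, progress toward RH.

Between two consecutive half-log-prime-powers the two-point gap of the zeta screw line is
`2Ψ(s) − Ψ(2s) = D(s) + (log 2/√2)(2s − log 2) + (αs + β)` with an AFFINE remainder `αs + β` (the prime ramps of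
`two_mul_zetaScrew_sub_eq_gap_add_primeSums` are linear while no new prime power enters). Since
`D + (log 2/√2)(2s − log 2)` is concave on meshes `≥ (log 2)/2` (`gap_add_prime_concave`), positivity on a piece
follows from positivity at its two end-points. `gap_affine_pos_between` packages this once, so that every further
rung of the ladder (`…Prime`, `…LogTwo`, `…LogFive`, `…LogSeven`, and any successor piece `[(log q)/2, (log q')/2]`)
needs only: the prime-sum evaluation on the piece, `ring` to exhibit `α, β`, and ONE rational certificate at the new
end-point. Nothing here bears on the truth of RH. References: M. Suzuki, J. Lond. Math. Soc. (2) 108 (2023) =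
arXiv:2206.03682, (1.1) [Suzuki2023]. -/

set_option linter.dupNamespace false

noncomputable section

open scoped BigOperators
open Set
namespace Summit.RiemannHypothesis.RiemannHypothesis.Theorems.DbrWall

open Literature.NumberTheory.LFunctions

/-- **Ladder lemma**: let `x ≥ (log 2)/2`, `x ≤ s ≤ y`, and suppose the function
`F(t) = D(t) + (log 2/√2)(2t − log 2) + (αt + β)` is positive at `t = x` and at `t = y`; then `F(s) > 0`
(concavity of `D + (log 2/√2)(2t − log 2)` on `[(log 2)/2, ∞)`, affinity of the remainder). [folklore] -/
theorem gap_affine_pos_between {x y s α β : ℝ} (hx : Real.log 2 / 2 ≤ x) (hxs : x ≤ s) (hsy : s ≤ y)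
    (h0 : 0 < (∑' k : ℕ, (1 - Real.exp (-((2 * (k : ℝ) + 5 / 2) * x))) ^ 2 / (2 * (k : ℝ) + 5 / 2) ^ 2)
      - 4 * (Real.exp (x / 2) - 1) ^ 2 + Real.log 2 / Real.sqrt 2 * (2 * x - Real.log 2) + (α * x + β))
    (h1 : 0 < (∑' k : ℕ, (1 - Real.exp (-((2 * (k : ℝ) + 5 / 2) * y))) ^ 2 / (2 * (k : ℝ) + 5 / 2) ^ 2)
      - 4 * (Real.exp (y / 2) - 1) ^ 2 + Real.log 2 / Real.sqrt 2 * (2 * y - Real.log 2) + (α * y + β)) :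
    0 < (∑' k : ℕ, (1 - Real.exp (-((2 * (k : ℝ) + 5 / 2) * s))) ^ 2 / (2 * (k : ℝ) + 5 / 2) ^ 2)
      - 4 * (Real.exp (s / 2) - 1) ^ 2 + Real.log 2 / Real.sqrt 2 * (2 * s - Real.log 2) + (α * s + β) := by
  rcases eq_or_lt_of_le (hxs.trans hsy) with hxy | hxy
  · -- degenerate piece: `s = x`
    have hsx : s = x := le_antisymm (hxy ▸ hsy) hxs
    rw [hsx]
    exact h0
  have hd : 0 < y - x := by linarith
  set a : ℝ := (y - s) / (y - x) with ha
  set b : ℝ := (s - x) / (y - x) with hb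
  have ha0 : 0 ≤ a := div_nonneg (by linarith) hd.le
  have hb0 : 0 ≤ b := div_nonneg (by linarith) hd.le
  have hab : a + b = 1 := by rw [ha, hb, ← add_div, div_eq_one_iff_eq hd.ne']; ring
  have hs : a * x + b * y = s := by
    rw [ha, hb]; field_simp; ring
  have hc := gap_add_prime_concave (x := x) (y := y) hx (by linarith) ha0 hb0 hab
  rw [hs] at hc
  have hlin : a * (α * x + β) + b * (α * y + β) = α * s + β := by
    have hb' : b = 1 - a := by linarith
    rw [← hs, hb']; ring
  have hmin : 0 < a * ((∑' k : ℕ, (1 - Real.exp (-((2 * (k : ℝ) + 5 / 2) * x))) ^ 2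
        / (2 * (k : ℝ) + 5 / 2) ^ 2)
      - 4 * (Real.exp (x / 2) - 1) ^ 2 + Real.log 2 / Real.sqrt 2 * (2 * x - Real.log 2) + (α * x + β))
      + b * ((∑' k : ℕ, (1 - Real.exp (-((2 * (k : ℝ) + 5 / 2) * y))) ^ 2
        / (2 * (k : ℝ) + 5 / 2) ^ 2)
      - 4 * (Real.exp (y / 2) - 1) ^ 2 + Real.log 2 / Real.sqrt 2 * (2 * y - Real.log 2) + (α * y + β)) := by
    rcases le_total a b with hab' | hab'
    · have hb2 : 1 / 2 ≤ b := by linarith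
      have e1 := mul_nonneg ha0 h0.le
      have e2 := mul_le_mul_of_nonneg_right hb2 h1.le
      linarith
    · have ha2 : 1 / 2 ≤ a := by linarith
      have e1 := mul_nonneg hb0 h1.le
      have e2 := mul_le_mul_of_nonneg_right ha2 h0.le
      linarith
  linarith

/-- **Ladder lemma, `Ψ` form**: if on the piece `[x, y]` (`x ≥ (log 2)/2`) the two-point gap has the shape
`2Ψ(t) − Ψ(2t) = D(t) + (log 2/√2)(2t − log 2) + (αt + β)` and is positive at both end-points, then
`Ψ(2s) < 2Ψ(s)` for every `s ∈ [x, y]`. [folklore] -/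
theorem zetaScrew_two_mul_lt_two_mul_of_piece {x y α β : ℝ} (hx : Real.log 2 / 2 ≤ x)
    (hshape : ∀ t : ℝ, x ≤ t → t ≤ y → 2 * zetaScrew t - zetaScrew (2 * t) =
      (∑' k : ℕ, (1 - Real.exp (-((2 * (k : ℝ) + 5 / 2) * t))) ^ 2 / (2 * (k : ℝ) + 5 / 2) ^ 2)
      - 4 * (Real.exp (t / 2) - 1) ^ 2 + Real.log 2 / Real.sqrt 2 * (2 * t - Real.log 2) + (α * t + β))
    (h0 : 0 < 2 * zetaScrew x - zetaScrew (2 * x)) (h1 : 0 < 2 * zetaScrew y - zetaScrew (2 * y))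
    {s : ℝ} (hxs : x ≤ s) (hsy : s ≤ y) : zetaScrew (2 * s) < 2 * zetaScrew s := by
  have hxy : x ≤ y := hxs.trans hsy
  have h0' := h0
  have h1' := h1
  rw [hshape x le_rfl hxy] at h0'
  rw [hshape y hxy le_rfl] at h1'
  have h := gap_affine_pos_between hx hxs hsy h0' h1'
  rw [← hshape s hxs hsy] at h
  linarith

end Summit.RiemannHypothesis.RiemannHypothesis.Theorems.DbrWall
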